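import Mathlib
import Summits.Ventures.HodgeRepro.LitRankDodson2

/-!
# LitRankDodson — Dodson 1987 Thm 1.12: case (ii), assembly, the discharge

Blind cell `pub-hodge-repro`, seat lit-2. Part 3 of 3 of the former single file `LitRankDodson.lean` (split at the ≤ 400-line rule, gen 4; text of every declaration unchanged). Imports `LitRankDodson2` (and through it the rest of the chain).
-/

open Finset Polynomial
open scoped Pointwise

namespace HodgeRepro.Lit2

/-! ## §4  Case (ii) -/

namespace CMTriple

section ElemAbCase2

variable {G : Type*} [Group G] [Fintype G] [DecidableEq G] (T : CMTriple G)

/-- **Case (ii)**: every `g`-fixed vector of `V` is `h`-fixed.  Then `K = V ∩ ker N_g` carries the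
orthogonal idempotents `N_{g^j h}/q` (`j < q`), which sum to the identity on `K`; faithfulness forces
two of them to be nonzero, each contributing `q − 1` dimensions (Dodson p.55: "there is a
complementary subspace of dimension at least q − 1"). -/
theorem two_mul_le_rank_of_not_moved (hs : T.IsSimple) (hcore : T.H.normalCore = ⊥) (q : ℕ)
    (hq : q.Prime) (hq2 : q ≠ 2) {g h : G} (hg : orderOf g = q) (hh : orderOf h = q)
    (hgh : g * h = h * g) (hhg : h ∉ Subgroup.zpowers g)
    (hfix : ∀ u ∈ T.V, rt g u = u → rt h u = u) : 2 * q ≤ T.rank := by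
  classical
  haveI := Fact.mk hq
  have hq0 : (q : ℚ) ≠ 0 := by exact_mod_cast hq.ne_zero
  have hg1 : g ^ q = 1 := by rw [← hg, pow_orderOf_eq_one]
  have hgne : g ≠ 1 := by
    intro h1; rw [h1, orderOf_one] at hg; exact hq.one_lt.ne hg
  -- the operators `M j = N_{g^j h}`, commuting with `rt g` and `N_g`
  set M : ℕ → Module.End ℚ (G → ℚ) := fun j => normOp (g ^ j * h) q with hM
  have hyq : ∀ j, (g ^ j * h) ^ q = 1 := fun j => by
    rw [← orderOf_pow_mul hq hg hh hgh hhg j, pow_orderOf_eq_one]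
  have hgy : ∀ j, g * (g ^ j * h) = (g ^ j * h) * g := fun j => by
    rw [← mul_assoc, ← pow_succ', pow_succ, mul_assoc, hgh, ← mul_assoc]
  have hMg : ∀ j, M j * rt g = rt g * M j := fun j => (rt_comm_normOp (hgy j) q).symm
  have hMN : ∀ j, M j * normOp g q = normOp g q * M j := fun j =>
    (normOp_comm_normOp (hgy j) q q).symm
  have hMM : ∀ j, M j * M j = (q : ℚ) • M j := fun j => normOp_mul_normOp _ q (hyq j)
  have hyM : ∀ j, rt (g ^ j * h) * M j = M j := fun j => rt_mul_normOp _ q (hyq j)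
  -- `K = V ∩ ker N_g`
  set K : Submodule ℚ (G → ℚ) := LinearMap.ker (normOp g q) ⊓ T.V with hK
  have hMK : ∀ j, ∀ u ∈ K, M j u ∈ K := by
    intro j u hu
    rw [hK, Submodule.mem_inf, LinearMap.mem_ker] at hu ⊢
    refine ⟨?_, T.normOp_mem_V _ _ hu.2⟩
    rw [← Module.End.mul_apply, ← hMN j, Module.End.mul_apply, hu.1, map_zero]
  -- `Σ_j M j = q` on `K`
  have hsum : ∀ u ∈ K, (∑ j : Fin q, M (j : ℕ)) u = (q : ℚ) • u := by
    intro u hu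
    rw [hK, Submodule.mem_inf, LinearMap.mem_ker] at hu
    rw [hM]
    simp only
    rw [sum_normOp_pow_mul hq hg hgh, LinearMap.add_apply, LinearMap.smul_apply,
      Module.End.one_apply, Module.End.mul_apply, hu.1, map_zero, add_zero]
  -- a nonzero vector of `K`
  obtain ⟨w₁, hw₁V, hw₁N, hw₁0⟩ := T.exists_mem_V_ker_normOp_ne_zero hs hcore hgne q hg1
  have hw₁K : w₁ ∈ K := by rw [hK, Submodule.mem_inf, LinearMap.mem_ker]; exact ⟨hw₁N, hw₁V⟩
  -- two indices with `M j K ≠ 0`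
  have hij : ∃ j j' : Fin q, j ≠ j' ∧ (∃ k ∈ K, M j k ≠ 0) ∧ (∃ k ∈ K, M j' k ≠ 0) := by
    by_contra hcon
    -- some `j₀` with `M j₀ w₁ ≠ 0`
    have hex : ∃ j₀ : Fin q, M j₀ w₁ ≠ 0 := by
      by_contra hall
      have hall' : ∀ j : Fin q, M j w₁ = 0 := fun j => by
        by_contra h; exact hall ⟨j, h⟩
      have := hsum w₁ hw₁K
      rw [LinearMap.sum_apply] at this
      simp only [hall', Finset.sum_const_zero] at this
      exact hw₁0 ((smul_eq_zero.mp this.symm).resolve_left hq0)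
    obtain ⟨j₀, hj₀⟩ := hex
    -- every other `M j` vanishes on `K`
    have hother : ∀ j : Fin q, j ≠ j₀ → ∀ k ∈ K, M j k = 0 := by
      intro j hj k hk
      by_contra hne
      exact hcon ⟨j, j₀, hj, ⟨k, hk, hne⟩, ⟨w₁, hw₁K, hj₀⟩⟩
    -- so `y = g^{j₀} h` fixes `K`
    set y := g ^ (j₀ : ℕ) * h with hy
    have hyK : ∀ u ∈ K, rt y u = u := by
      intro u hu
      have h1 := hsum u hu
      rw [LinearMap.sum_apply, Finset.sum_eq_single j₀ (fun j _ hj => hother j hj u hu)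
        (fun h => absurd (Finset.mem_univ j₀) h)] at h1
      have h2 : rt y (M j₀ u) = M j₀ u := by
        rw [← Module.End.mul_apply, hyM]
      rw [h1, map_smul] at h2
      exact smul_right_injective _ hq0 h2
    -- and `y` fixes `V ∩ Fix(g)` (by `hfix`), hence all of `V`
    have hyFix : ∀ u ∈ T.V, rt g u = u → rt y u = u := by
      intro u hu hgu
      have hhu := hfix u hu hgu
      have hgk : ∀ k : ℕ, rt (g ^ k) u = u := by
        intro k
        induction k with
        | zero => rw [pow_zero, rt_one]; rfl
        | succ n ih => rw [← rt_pow, pow_succ, Module.End.mul_apply, rt_pow, hgu, ih]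
      rw [hy, ← rt_comp, LinearMap.comp_apply, hgk, hhu]
    have hyV : ∀ u ∈ T.V, rt y u = u := by
      intro u hu
      have hdec : u = (q : ℚ)⁻¹ • normOp g q u + (u - (q : ℚ)⁻¹ • normOp g q u) := by abel
      have h1 : (q : ℚ)⁻¹ • normOp g q u ∈ T.V := T.V.smul_mem _ (T.normOp_mem_V _ _ hu)
      have h1g : rt g ((q : ℚ)⁻¹ • normOp g q u) = (q : ℚ)⁻¹ • normOp g q u := by
        rw [map_smul, ← Module.End.mul_apply, rt_mul_normOp g q hg1]
      have h2 : u - (q : ℚ)⁻¹ • normOp g q u ∈ K := by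
        rw [hK, Submodule.mem_inf, LinearMap.mem_ker]
        refine ⟨?_, T.V.sub_mem hu h1⟩
        rw [map_sub, map_smul, ← Module.End.mul_apply (normOp g q) (normOp g q),
          normOp_mul_normOp g q hg1, LinearMap.smul_apply, smul_smul, inv_mul_cancel₀ hq0, one_smul,
          sub_self]
      conv_lhs => rw [hdec]
      rw [map_add, hyFix _ h1 h1g, hyK _ h2, ← hdec]
    -- contradiction with faithfulness
    have hy1 : y ≠ 1 := by
      intro h1
      have := orderOf_pow_mul hq hg hh hgh hhg (j₀ : ℕ)
      rw [← hy, h1, orderOf_one] at this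
      exact hq.one_lt.ne this
    obtain ⟨x, hx⟩ := T.exists_image_mul_ne_of_core hs hcore hy1
    apply hx
    have := hyV _ (T.indFun_image_mem_V x)
    rw [T.rt_indFun_image] at this
    exact indFun_injective this
  obtain ⟨j, j', hjj, ⟨k, hkK, hk⟩, ⟨k', hk'K, hk'⟩⟩ := hij
  -- the two `(q−1)`-dimensional pieces
  have hpiece : ∀ (i : Fin q) (k : G → ℚ), k ∈ K → M i k ≠ 0 →
      ∃ U : Submodule ℚ (G → ℚ), Module.finrank ℚ U = q - 1 ∧ U ≤ T.V ∧
        U ≤ LinearMap.ker (normOp g q) ∧ U ≤ LinearMap.ker (M i - (q : ℚ) • 1) := by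
    intro i k hkK hk
    have huK := hMK i k hkK
    rw [hK, Submodule.mem_inf, LinearMap.mem_ker] at huK
    refine ⟨Submodule.span ℚ (Set.range fun l : Fin (q - 1) => ((rt g) ^ (l : ℕ)) (M i k)),
      finrank_span_rt_pow g q hk huK.1, T.span_rt_pow_le_V g huK.2 _, ?_, ?_⟩
    · exact span_pow_le_ker (rt g) (normOp g q)
        ((normOp_mul_rt g q hg1).trans (rt_mul_normOp g q hg1).symm) huK.1 _
    · refine span_pow_le_ker (rt g) (M i - (q : ℚ) • 1) ?_ ?_ _
      · rw [sub_mul, mul_sub, smul_mul_assoc, mul_smul_comm, one_mul, mul_one, hMg]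
      · rw [LinearMap.sub_apply, LinearMap.smul_apply, Module.End.one_apply, ← Module.End.mul_apply,
          hMM, LinearMap.smul_apply, sub_self]
  obtain ⟨U, hUrank, hUV, hUN, hUM⟩ := hpiece j k hkK hk
  obtain ⟨U', hU'rank, hU'V, hU'N, hU'M⟩ := hpiece j' k' hk'K hk'
  obtain ⟨V₀, hV₀rank, hV₀V, hV₀g, _⟩ := T.exists_fixed_two q hq hq2 hg hh hgh
  -- `U ⊓ U' = ⊥` by orthogonality `M j M j' = N_g M j'`
  have hUU : U ⊓ U' = ⊥ := by
    rw [eq_bot_iff]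
    intro v hv
    rw [Submodule.mem_inf] at hv
    have h1 : M j v = (q : ℚ) • v := by
      have := hUM hv.1
      rwa [LinearMap.mem_ker, LinearMap.sub_apply, LinearMap.smul_apply, Module.End.one_apply,
        sub_eq_zero] at this
    have h2 : M j' v = (q : ℚ) • v := by
      have := hU'M hv.2
      rwa [LinearMap.mem_ker, LinearMap.sub_apply, LinearMap.smul_apply, Module.End.one_apply,
        sub_eq_zero] at this
    have h3 : normOp g q v = 0 := by
      have := hUN hv.1
      rwa [LinearMap.mem_ker] at this
    have h4 : M j (M j' v) = normOp g q (M j' v) := by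
      rw [← Module.End.mul_apply, hM]
      simp only
      rw [normOp_pow_mul_mul hq hg hh hgh hhg j.isLt j'.isLt (Fin.val_ne_of_ne hjj),
        Module.End.mul_apply]
    rw [h2, map_smul, h1, map_smul, h3, smul_zero, smul_smul] at h4
    rw [Submodule.mem_bot]
    exact (smul_eq_zero.mp h4).resolve_left (mul_ne_zero hq0 hq0)
  have hUUV : (U ⊔ U') ⊓ V₀ = ⊥ := by
    rw [eq_bot_iff]
    refine le_trans (inf_le_inf (sup_le hUN hU'N) hV₀g) ?_
    rw [inf_comm, ker_sub_one_inf_ker_normOp g q hq.ne_zero]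
  have := finrank_add_three_le hUV hU'V hV₀V hUU hUUV
  rw [hUrank, hU'rank, hV₀rank, ← T.rank_eq_finrank_V] at this
  have := hq.two_le
  omega

end ElemAbCase2

end CMTriple

/-! ## §5  Assembly and the discharge -/

namespace CMTriple

section Assembly

variable {G : Type*} [Group G] [Fintype G] [DecidableEq G] (T : CMTriple G)

/-- **Dodson 1987 Theorem 1.12, faithful case**: `q² ∣ d` (`q` an odd prime) forces `rank ≥ 2q`.
Sylow gives a subgroup `A` of order `q²`; either `A` has an element of order `q²` (cyclic case) or
`A = ⟨g, h⟩` is elementary abelian and one of the two cases (i)/(ii) applies. -/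
theorem two_mul_le_rank_of_core (hs : T.IsSimple) (hcore : T.H.normalCore = ⊥) (q : ℕ)
    (hq : q.Prime) (hq2 : q ≠ 2) (hqd : q ^ 2 ∣ T.dim) : 2 * q ≤ T.rank := by
  classical
  haveI := Fact.mk hq
  -- a subgroup of order `q²`
  have hdvd : q ^ 2 ∣ Nat.card G := by
    rw [Nat.card_eq_fintype_card]; exact hqd.trans T.dim_dvd_card
  obtain ⟨A, hA⟩ := Sylow.exists_subgroup_card_pow_prime q hdvd
  by_cases hcyc : ∃ x ∈ A, orderOf x = q ^ 2
  · obtain ⟨x, _, hx⟩ := hcyc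
    exact T.two_mul_le_rank_of_orderOf_sq hs hcore q hq hq2 hx
  -- exponent `q`
  have hexp : ∀ x ∈ A, x ^ q = 1 := by
    intro x hx
    have h1 : orderOf x ∣ q ^ 2 := by
      have := orderOf_dvd_natCard (⟨x, hx⟩ : A)
      rw [hA, Subgroup.orderOf_mk] at this
      exact this
    obtain ⟨i, hi, hio⟩ := (Nat.dvd_prime_pow hq).mp h1
    have hi2 : i ≠ 2 := by
      intro h; apply hcyc; exact ⟨x, hx, by rw [hio, h]⟩
    have hio' : orderOf x ∣ q := by
      rw [hio]
      have : q ^ i ∣ q ^ 1 := pow_dvd_pow q (by omega)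
      rwa [pow_one] at this
    rw [← orderOf_dvd_iff_pow_eq_one]
    exact hio'
  -- `g ∈ A`, `g ≠ 1`
  have hAbot : A ≠ ⊥ := by
    intro h
    rw [h, Subgroup.card_bot] at hA
    have := hq.two_le
    nlinarith
  obtain ⟨g, hgA, hg1⟩ := A.bot_or_exists_ne_one.resolve_left hAbot
  have hg : orderOf g = q := orderOf_eq_prime (hexp g hgA) hg1
  -- `h ∈ A \ ⟨g⟩`
  have hhex : ∃ h ∈ A, h ∉ Subgroup.zpowers g := by
    by_contra hall
    have hle : A ≤ Subgroup.zpowers g := by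
      intro a ha
      by_contra hna
      exact hall ⟨a, ha, hna⟩
    have := Subgroup.card_le_of_le hle
    rw [hA, Nat.card_zpowers, hg] at this
    have := hq.two_le
    nlinarith
  obtain ⟨h, hhA, hhg⟩ := hhex
  have hh1 : h ≠ 1 := fun h1 => hhg (h1 ▸ Subgroup.one_mem _)
  have hh : orderOf h = q := orderOf_eq_prime (hexp h hhA) hh1
  -- `A` is commutative
  have hgh : g * h = h * g := by
    have hcomm := IsPGroup.isMulCommutative_of_card_eq_prime_sq (p := q) hA
    have := hcomm.is_comm.comm (⟨g, hgA⟩ : A) ⟨h, hhA⟩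
    exact congrArg Subtype.val this
  -- the two cases
  by_cases hmoved : ∃ u ∈ T.V, rt g u = u ∧ rt h u ≠ u
  · exact T.two_mul_le_rank_of_moved hs hcore q hq hq2 hg hh hgh hmoved
  · apply T.two_mul_le_rank_of_not_moved hs hcore q hq hq2 hg hh hgh hhg
    intro u hu hgu
    by_contra hne
    exact hmoved ⟨u, hu, hgu, hne⟩

end Assembly

end CMTriple

/-- **Dodson 1987 Theorem 1.12 holds**: for every simple CM triple and every odd prime `q` with
`q² ∣ d`, `rank ≥ 2q` (Dodson's printed argument, p.54–55, after the reduction to the faithful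
quotient `G / normalCore H`). -/
theorem Dodson1987_theorem1_12_holds : Dodson1987_theorem1_12 := by
  intro G _ _ _ T hs q hq hq2 hqd
  classical
  let N := T.H.normalCore
  letI : Fintype (G ⧸ N) := Fintype.ofFinite _
  have hN : N ≤ T.H := Subgroup.normalCore_le _
  have h := (T.quotientTriple N hN).two_mul_le_rank_of_core (T.quotientTriple_isSimple N hN hs)
    T.normalCore_map_eq_bot q hq hq2 (by rw [T.quotientTriple_dim]; exact hqd)
  rwa [T.quotientTriple_rank] at h

end HodgeRepro.Lit2
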